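import Mathlib.Analysis.SpecialFunctions.Exponential
import Mathlib.Analysis.Calculus.InverseFunctionTheorem.ContDiff
import Mathlib.Analysis.Calculus.ContDiff.Comp
import Literature.NumberTheory.Automorphic.AdelicGLnGlue
import HarnessLib

/-!
# Lie derivatives of archimedean-smooth functions are archimedean-smooth
(discharge of the named fact `isArchSmooth_lieDeriv` of `ArchimedeanCalculus` for `𝔤 = 𝔤𝔩(N, A)`)

Topic `NumberTheory/Automorphic`. Let `H : RealMatrixGroup A N` be a linear real group whose Lie
algebra is *all* of `𝔤𝔩(N, A)` (`H.lie = ⊤`; e.g. `RealMatrixGroup.gl`, and the archimedean group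
`archGroupGL n K = GL_n(K_∞)` of the `GL_n` automorphy datum), over a finite-dimensional
coefficient algebra `A`, and let `ι : H → G` be a homomorphism into a group. If `φ : G → ℂ` is
smooth in the archimedean variable (`IsArchSmooth ι φ`: `Y ↦ φ (g ι(exp Y))` is `C^∞` on `𝔤` for
every `g`), then so is every Lie derivative `X φ = d/dt φ (· ι(exp tX))|_{t=0}`
(Borel–Jacquet 1979, §1.5; Wallach, *Real Reductive Groups I*, §1.6.2):

* `isArchSmooth_lieDeriv_of_lie_eq_top` — the statement above;
* `isArchSmooth_lieDeriv_holds_of_lie_eq_top` — the named fact `isArchSmooth_lieDeriv (ι := ι)` of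
  `ArchimedeanCalculus` for such `H`; `isArchSmooth_lieDeriv_gl` — in particular for the `GL_n`
  datum (`(AutomorphyDatum.gl n K hcpt).ofArch`).

Proof (the exponential chart): fix `g` and `Y₀ ∈ 𝔤`. Near `(Y₀, 0)` one has
`exp Y · exp (tX) = exp Y₀ · exp (L(Y, t))` with `L(Y, t) = log (exp(-Y₀) exp(Y) exp(tX))`, where
`log` is the smooth local inverse of `exp` at `0` given by the inverse function theorem
(`hasStrictFDerivAt_exp_zero`, `ContDiffAt.to_localInverse`; `exp` is analytic,
`NormedSpace.exp_analytic`). Hence `(Y, t) ↦ φ (g ι(exp Y) ι(exp tX)) = Φ_{g ι(exp Y₀)} (L(Y, t))`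
is `C^∞` near `(Y₀, 0)` (`Φ_{g'} = (Z ↦ φ (g' ι(exp Z)))` being `C^∞` by hypothesis), and
`Y ↦ (X φ)(g ι(exp Y)) = ∂_t|₀` of it is `C^∞` near `Y₀` (`ContDiffAt.fderiv`). No Baker–Campbell–
Hausdorff theory is needed because `𝔤` is the full matrix algebra, so that `L(Y, t) ∈ 𝔤`
trivially. Everything here is proved.

## References

* A. Borel, H. Jacquet, *Automorphic forms and automorphic representations*, Proc. Sympos. Pure
  Math. 33 (1979), part 1, §1.5 [BorelJacquet1979].
* N. R. Wallach, *Real Reductive Groups I* (1988), §1.6.2 [WallachRRG1].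
* A. W. Knapp, *Lie Groups Beyond an Introduction* (2002), 0.§2–§3 (`exp` near `0`) [Knapp2002].
-/

noncomputable section

open scoped MatrixGroups Matrix ContDiff Topology
open Filter

namespace Literature.NumberTheory.Automorphic

section General

variable {A : Type*} [NormedCommRing A] [NormedAlgebra ℝ A] [NormedAlgebra ℚ A] [CompleteSpace A]
  [StarRing A] {N : Type*} [Fintype N] [DecidableEq N] {H : RealMatrixGroup A N}
  {G : Type*} [Group G] (ι : H.carrier →* G)

-- As in `Mathlib/Analysis/Normed/Algebra/MatrixExponential.lean` and `AutomorphicFormsGLContinuous`: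
-- the scoped `L∞`-operator normed ring structure on matrices is only reducibly-defeq to the Pi
-- uniformity, so `CompleteSpace (Matrix N N A)` and the analytic facts about `exp` need this setting.
set_option backward.isDefEq.respectTransparency false in
open scoped Matrix.Norms.Operator in
/-- **Lie derivatives preserve archimedean smoothness when `𝔤 = 𝔤𝔩(N, A)`.** If `H.lie = ⊤`, `A` is
finite-dimensional and `φ` is smooth in the archimedean variable, then so is `X φ` for every
`X ∈ 𝔤`: near `(Y₀, 0)`, `φ (g ι(exp Y) ι(exp tX)) = Φ (log (exp(-Y₀) exp Y exp tX))` with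
`Φ = (Z ↦ φ (g ι(exp Y₀) ι(exp Z)))` smooth and `log` the smooth local inverse of `exp` at `0`, so
`Y ↦ (X φ)(g ι(exp Y))` is the `t`-derivative at `0` of a function smooth in `(Y, t)`.
Borel–Jacquet 1979, §1.5; Wallach, *Real Reductive Groups I*, §1.6.2. [cite: BorelJacquet1979, §1.5] -/
theorem isArchSmooth_lieDeriv_of_lie_eq_top [FiniteDimensional ℝ A] (hH : H.lie = ⊤) (X : H.lie)
    {φ : G → ℂ} (hφ : IsArchSmooth ι φ) : IsArchSmooth ι (lieDeriv ι X φ) := by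
  -- Mathlib idiom (Mathlib/Algebra/Lie/OfAssociative.lean): the commutator Lie ring on matrices
  letI : LieRing (Matrix N N A) := LieRing.ofAssociativeRing
  -- membership in `𝔤 = ⊤` is free
  have hmem : ∀ M : Matrix N N A, M ∈ H.lie := fun M => by rw [hH]; exact LieSubalgebra.mem_top M
  -- the exponential `𝔤𝔩 → H`
  let E : Matrix N N A → H.carrier := fun M => H.expMem ⟨M, hmem M⟩
  -- the slices of `φ` as functions on all of `𝔤𝔩(N, A)` are smooth
  let incl : Matrix N N A →ₗ[ℝ] H.lie.toSubmodule :=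
    LinearMap.codRestrict H.lie.toSubmodule LinearMap.id fun M => hmem M
  have hincl : ContDiff ℝ ∞ (incl : Matrix N N A → H.lie.toSubmodule) :=
    (⟨incl, incl.continuous_of_finiteDimensional⟩ : Matrix N N A →L[ℝ] H.lie.toSubmodule).contDiff
  have hΦ : ∀ g' : G, ContDiff ℝ ∞ fun M : Matrix N N A => φ (g' * ι (E M)) := fun g' =>
    (hφ g').comp hincl
  -- analytic facts about `exp` on the Banach algebra `Matrix N N A`
  have hexp : ContDiff ℝ ∞ (NormedSpace.exp : Matrix N N A → Matrix N N A) :=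
    contDiff_iff_contDiffAt.2 fun M => (NormedSpace.exp_analytic (𝕂 := ℝ) M).contDiffAt
  have hexp0 : HasFDerivAt (NormedSpace.exp : Matrix N N A → Matrix N N A)
      ((ContinuousLinearEquiv.refl ℝ (Matrix N N A) : Matrix N N A ≃L[ℝ] Matrix N N A) :
        Matrix N N A →L[ℝ] Matrix N N A) 0 :=
    (hasFDerivAt_exp_zero (𝕂 := ℝ) (𝔸 := Matrix N N A)).congr_fderiv (by ext M; simp)
  have hn : (∞ : WithTop ℕ∞) ≠ 0 := by simp
  -- the smooth local inverse `log` of `exp` at `0`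
  set log : Matrix N N A → Matrix N N A := hexp.contDiffAt.localInverse hexp0 hn with hlog_def
  have hlog : ContDiffAt ℝ ∞ log 1 := by
    have := hexp.contDiffAt.to_localInverse hexp0 hn
    rwa [NormedSpace.exp_zero] at this
  have hright : ∀ᶠ y in 𝓝 (1 : Matrix N N A), NormedSpace.exp (log y) = y := by
    have := (hexp.contDiffAt.hasStrictFDerivAt' hexp0 hn).eventually_right_inverse
    rwa [NormedSpace.exp_zero] at this
  -- reduce to functions on all of `𝔤𝔩(N, A)`
  intro g
  suffices hF : ContDiff ℝ ∞ fun M : Matrix N N A => lieDeriv ι X φ (g * ι (E M)) from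
    hF.comp H.lie.toSubmodule.subtypeL.contDiff
  refine contDiff_iff_contDiffAt.2 fun M₀ => ?_
  -- the two-variable function `(M, t) ↦ φ (g ι(exp M) ι(exp tX))`
  set f2 : Matrix N N A × ℝ → ℂ := fun p => φ (g * ι (E p.1) * ι (H.expMem (p.2 • X))) with hf2_def
  -- Step A: `f2` is smooth at `(M₀, 0)`, through the exponential chart at `exp M₀`
  have hA : ContDiffAt ℝ ∞ f2 (M₀, 0) := by
    set u₀ : GL N A := expGL M₀ with hu₀
    set P : Matrix N N A × ℝ → Matrix N N A := fun p =>
      ((u₀⁻¹ : GL N A) : Matrix N N A) * (NormedSpace.exp p.1 * NormedSpace.exp (p.2 • (X : Matrix N N A)))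
      with hP_def
    have hP : ContDiff ℝ ∞ P :=
      contDiff_const.mul ((hexp.comp contDiff_fst).mul (hexp.comp (contDiff_snd.smul contDiff_const)))
    have hP0 : P (M₀, 0) = 1 := by
      simp only [hP_def, zero_smul, NormedSpace.exp_zero, mul_one]
      rw [hu₀, ← coe_expGL, Units.inv_mul]
    set Gf : Matrix N N A × ℝ → ℂ := fun p => φ (g * ι (E M₀) * ι (E (log (P p)))) with hGf_def
    have hGf : ContDiffAt ℝ ∞ Gf (M₀, 0) := by
      have h1 : ContDiffAt ℝ ∞ (fun p : Matrix N N A × ℝ => log (P p)) (M₀, 0) := by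
        refine ContDiffAt.comp (M₀, 0) ?_ hP.contDiffAt
        rwa [hP0]
      exact ((hΦ (g * ι (E M₀))).contDiffAt).comp (M₀, 0) h1
    have hPcont : Tendsto P (𝓝 (M₀, 0)) (𝓝 1) := by
      have := hP.continuous.continuousAt (x := (M₀, 0))
      rwa [ContinuousAt, hP0] at this
    have heq : f2 =ᶠ[𝓝 (M₀, 0)] Gf := by
      filter_upwards [hPcont.eventually hright] with p hp
      have key : E p.1 * H.expMem (p.2 • X) = E M₀ * E (log (P p)) := by
        refine Subtype.ext (Units.ext ?_)
        change NormedSpace.exp p.1 * NormedSpace.exp (((p.2 • X : H.lie) : Matrix N N A)) =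
          NormedSpace.exp M₀ * NormedSpace.exp (log (P p))
        rw [hp, hP_def]
        dsimp only
        rw [hu₀, ← coe_expGL M₀, Units.mul_inv_cancel_left (expGL M₀)]
        rfl
      simp only [hf2_def, hGf_def]
      rw [mul_assoc, ← map_mul, mul_assoc, ← map_mul, key]
    exact hGf.congr_of_eventuallyEq heq
  -- Step B: `M ↦ ∂_t|₀ f2 (M, t)` is smooth at `M₀`
  have hB : ContDiffAt ℝ ∞ (fun M : Matrix N N A => fderiv ℝ (fun t : ℝ => f2 (M, t)) 0) M₀ := by
    have hunc : (Function.uncurry fun (M : Matrix N N A) (t : ℝ) => f2 (M, t)) = f2 := by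
      funext p; rfl
    refine ContDiffAt.fderiv (𝕜 := ℝ) (n := ∞) (m := ∞) (f := fun M t => f2 (M, t))
      (g := fun _ => (0 : ℝ)) ?_ contDiffAt_const (le_of_eq rfl)
    rw [hunc]
    exact hA
  have hB' : ContDiffAt ℝ ∞ (fun M : Matrix N N A => fderiv ℝ (fun t : ℝ => f2 (M, t)) 0 (1 : ℝ)) M₀ :=
    hB.clm_apply contDiffAt_const
  -- `(X φ)(g ι(exp M)) = ∂_t|₀ f2 (M, t)` by definition of the Lie derivative
  have hFeq : (fun M : Matrix N N A => lieDeriv ι X φ (g * ι (E M))) =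
      fun M => fderiv ℝ (fun t : ℝ => f2 (M, t)) 0 (1 : ℝ) := by
    funext M
    rw [fderiv_apply_one_eq_deriv]
    rfl
  rw [hFeq]
  exact hB'

/-- **Discharge of the named fact `isArchSmooth_lieDeriv` for `𝔤 = 𝔤𝔩(N, A)`**: for a linear real
group `H` with `H.lie = ⊤` and any homomorphism `ι : H → G`, Lie derivatives of
archimedean-smooth functions on `G` are archimedean-smooth (finite-dimensional coefficients).
Borel–Jacquet 1979, §1.5. [cite: BorelJacquet1979, §1.5] -/
theorem isArchSmooth_lieDeriv_holds_of_lie_eq_top (hH : H.lie = ⊤) :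
    isArchSmooth_lieDeriv (ι := ι) :=
  fun X _ hφ => isArchSmooth_lieDeriv_of_lie_eq_top ι hH X hφ

end General

/-! ### The `GL_n` datum -/

section GLn

open scoped Classical
open NumberField NumberField.mixedEmbedding IsDedekindDomain

variable {n : ℕ} {K : Type} [Field K] [NumberField K]

/-- **Lie derivatives of archimedean-smooth functions on `GL_n(𝔸_K)` are archimedean-smooth**:
the named fact `isArchSmooth_lieDeriv` of `ArchimedeanCalculus` holds for the archimedean
inclusion `(AutomorphyDatum.gl n K hcpt).ofArch : GL_n(K_∞) → GL_n(𝔸_K)` (`𝔤 = 𝔤𝔩_n(K_∞)` is the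
full matrix algebra, `archGroupGL_lie`). Borel–Jacquet 1979, §1.5 and §4.1. [cite: BorelJacquet1979, §1.5] -/
theorem isArchSmooth_lieDeriv_gl (hcpt : isCompact_glFiniteIntegralLevel n K) :
    isArchSmooth_lieDeriv (ι := (AutomorphyDatum.gl n K hcpt).ofArch) :=
  isArchSmooth_lieDeriv_holds_of_lie_eq_top _ (archGroupGL_lie n K)

/-- Pointwise form for `GL_n`: if `φ : GL_n(𝔸_K) → ℂ` is smooth in the archimedean variable, so is
`X φ` for every `X ∈ 𝔤𝔩_n(K_∞)`. Borel–Jacquet 1979, §1.5 and §4.1. [cite: BorelJacquet1979, §1.5] -/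
theorem IsArchSmooth.lieDeriv_gl {hcpt : isCompact_glFiniteIntegralLevel n K}
    {φ : (AdelicGroupData.gl n K).Adelic → ℂ}
    (hφ : IsArchSmooth (AutomorphyDatum.gl n K hcpt).ofArch φ)
    (X : (AutomorphyDatum.gl n K hcpt).arch.lie) :
    IsArchSmooth (AutomorphyDatum.gl n K hcpt).ofArch
      (lieDeriv (AutomorphyDatum.gl n K hcpt).ofArch X φ) :=
  isArchSmooth_lieDeriv_gl hcpt X hφ

end GLn

end Literature.NumberTheory.Automorphic
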